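import Literature.MathematicalPhysics.QuantumLattice.GriffithsLemmaGroundStates
import Literature.MathematicalPhysics.QuantumLattice.SectorEigenvalueContinuation
import HarnessLib

/-!
# Continuity of the sector ground projection along an affine Hermitian pencil, off a closed nowhere dense set

For Hermitian `H`, `Y` on `ι → ℂ` and a subspace ("sector") `K` invariant under both, consider
the affine pencil `A(u) = H + u Y` (`u ∈ ℝ`), its sector energy `e(u) = minEnergyOn A(u) K`
(bottom of the Rayleigh quotient on the unit sphere of `K`, `Matrix.minEnergyOn`), the **sector
ground multiplet** `E(u) = K ⊓ ker (A(u) - e(u))` and the orthogonal projection `P(u)` onto it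
(`projMatrix` of the transport of `E(u)` to `EuclideanSpace ℂ ι`) — exactly the objects in
which the Hubbard summit `Summits/HubbardSuperconductivity` phrases ground-state averages
`tr (P(u) O) / tr P(u)` in a sector `(N, S^z)` of the torus at coupling `u = U`.

**Main result** (`exists_isClosed_isNowhereDense_continuousOn_sectorGroundProj`, abstract form
`exists_isClosed_interior_empty_continuousOn_of_pencil`): for `K ≠ ⊥` there is a CLOSED set
`C ⊆ ℝ` with EMPTY INTERIOR such that `u ↦ P(u)` is continuous on `ℝ \ C` and `dim E(u)` is
locally constant there. This is the finite-dimensional content of Kato's continuity of the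
total projection of an eigenvalue group that does not split (cf. Kato (1966) II-§1.4, II-§5.1),
in an elementary u.s.c. form that needs no analyticity; finiteness of `C` on bounded intervals
(Rellich; Kato (1966) II-§6.1) is NOT claimed.

Ingredients, for one Hermitian `A` with invariant sector `K` (`e = minEnergyOn A K`,
`E = K ⊓ ker (A - e)`, `P_E` its projection):

* `minEnergyOn_mul_le_re_rayleigh` — the variational principle `e ‖v‖² ≤ Re ⟨v, A v⟩` on `K`;
  `exists_unit_eigen_minEnergyOn` — for `K ≠ ⊥` a unit `ψ ∈ K` with `A ψ = e ψ` (compactness of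
  the unit sphere of `K`; Tasaki (2020) §2.2);
* `exists_gap_above_groundMultiplet` — **the gap**: some `g > 0` with
  `(e + g) ‖w‖² ≤ Re ⟨w, A w⟩` for every `w ∈ K` orthogonal to `E` (minimise on the unit sphere
  of `K ∩ E^⊥`; a minimiser of energy `e` would lie in `E ∩ E^⊥ = 0`) — the degenerate version
  of `EigenvalueContinuation.exists_gap_of_unique`; projection form `exists_gap_groundProj_form`:
  `e ‖v‖² + g (‖v‖² - Re ⟨v, P_E v⟩) ≤ Re ⟨v, A v⟩` on `K`;
* `exists_frame_trace_projMatrix_map_mul` — `tr (P_E M) = Σⱼ ⟨bⱼ, M bⱼ⟩` over an orthonormal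
  frame of `E`; hence `Re tr P_E = dim E` (`re_trace_projMatrix_map_eq_finrank`) and
  `Re tr (Q P_E) ≤ dim E` for a Hermitian idempotent `Q` (`re_trace_mul_projMatrix_map_le`);
* `abs_re_rayleigh_le_sum_norm` (`|Re ⟨b, Y b⟩| ≤ Σᵢₖ |Yᵢₖ|` for unit `b`) and
  `norm_sub_apply_sq_le_of_proj` (for Hermitian idempotents `P`, `Q` of equal trace `d`,
  `|(P - Q)ᵢⱼ|² ≤ 2 (d - Re tr (P Q))`, the Hilbert–Schmidt distance);
* `gap_mul_finrank_sub_re_trace_le` — the **core estimate**: if `A₀` has the gap form on `K`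
  and every unit vector of a subspace `E₁ ≤ K` has `Re ⟨b, A₀ b⟩ ≤ α`, then
  `g (dim E₁ - Re tr (P_{E₁} P₀)) ≤ dim E₁ · (α - e₀)`.

Proof of the main result: the core estimate at `u₀` (gap `g`; `α - e₀ ≤ |u - u₀| (|⟨ψ₀, Y ψ₀⟩|
+ Σ|Yᵢₖ|)` by the supergradient inequality `minEnergyOn_pencil_le_of_ground`) gives
`g (dim E(u) - Re tr (P(u) P(u₀))) ≤ M |u - u₀|` while `Re tr (P(u) P(u₀)) ≤ dim E(u₀)`; hence
(i) `dim E` is upper semicontinuous, and (ii) where `dim E` is locally constant,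
`Σᵢⱼ |P(u) - P(u₀)|ᵢⱼ² = 2 (dim - Re tr (P(u) P(u₀))) → 0`. `C` is the set of points where the
u.s.c. integer function `dim E` is not locally constant: closed, with empty interior (on an open
set a point of minimal `dim E` is a point of local constancy).

All statements are folklore linear algebra / point-set topology; no definition is introduced.

## References

* T. Kato, *Perturbation Theory for Linear Operators*, Springer 1966, II-§1.4, §5.1, §6.1.
* H. Tasaki, *Physics and Mathematics of Quantum Many-Body Systems*, Springer 2020, §2.2,
  App. A.2.
-/

noncomputable section

namespace Literature.MathematicalPhysics.QuantumLattice

open Matrix Set Filter Topology Literature.Computability.AlgebraicComplexity EigenvalueContinuation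

variable {ι : Type*} [Fintype ι] [DecidableEq ι]

/-! ### The variational principle and the ground multiplet -/

omit [Fintype ι] [DecidableEq ι] in
/-- Real multiples of a Hermitian matrix added to a Hermitian matrix are Hermitian: every member
`H + u Y` (`u ∈ ℝ`) of an affine pencil is Hermitian. [folklore] -/
theorem isHermitian_add_ofReal_smul {H Y : Matrix ι ι ℂ} (hH : H.IsHermitian)
    (hY : Y.IsHermitian) (u : ℝ) : (H + (u : ℂ) • Y).IsHermitian := by
  refine hH.add ?_
  rw [IsHermitian, conjTranspose_smul, hY.eq, Complex.star_def, Complex.conj_ofReal]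

/-- Membership in the sector ground multiplet `K ⊓ ker (A - e)`: `ψ ∈ K` and `A ψ = e ψ`.
[folklore] -/
theorem mem_inf_eigenspace_toLin'_iff (A : Matrix ι ι ℂ) (K : Submodule ℂ (ι → ℂ)) (e : ℝ)
    (ψ : ι → ℂ) :
    ψ ∈ K ⊓ Module.End.eigenspace (Matrix.toLin' A) (e : ℂ) ↔ ψ ∈ K ∧ A *ᵥ ψ = (e : ℂ) • ψ := by
  rw [Submodule.mem_inf, Module.End.mem_eigenspace_iff, Matrix.toLin'_apply]

omit [DecidableEq ι] in
/-- **Variational principle in a sector** (all vectors, not only unit ones): for Hermitian `A`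
and `v ∈ K`, `minEnergyOn A K · Re ⟨v, v⟩ ≤ Re ⟨v, A v⟩`. Tasaki (2020) §2.2. [folklore] -/
theorem minEnergyOn_mul_le_re_rayleigh {A : Matrix ι ι ℂ} (hA : A.IsHermitian)
    (K : Submodule ℂ (ι → ℂ)) {v : ι → ℂ} (hv : v ∈ K) :
    A.minEnergyOn K * (star v ⬝ᵥ v).re ≤ (star v ⬝ᵥ A *ᵥ v).re := by
  classical
  by_cases hv0 : v = 0
  · simp [hv0]
  obtain ⟨c, _, hcc, h1⟩ := exists_normalize hv0
  have hle := minEnergyOn_le_rayleigh_of_mem hA K (K.smul_mem (c : ℂ) hv) h1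
  rw [mulVec_smul, star_real_smul_dotProduct_real_smul, Complex.re_ofReal_mul] at hle
  have hpos := re_star_dotProduct_self_pos hv0
  calc A.minEnergyOn K * (star v ⬝ᵥ v).re
      ≤ c * c * (star v ⬝ᵥ A *ᵥ v).re * (star v ⬝ᵥ v).re :=
        mul_le_mul_of_nonneg_right hle hpos.le
    _ = (star v ⬝ᵥ A *ᵥ v).re * (c * c * (star v ⬝ᵥ v).re) := by ring
    _ = (star v ⬝ᵥ A *ᵥ v).re := by rw [hcc, mul_one]

omit [DecidableEq ι] in
/-- **The sector energy is attained at an eigenvector.** For Hermitian `A`, an `A`-invariant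
sector `K ≠ ⊥` has a unit vector `ψ ∈ K` with `A ψ = (minEnergyOn A K) ψ` (minimise the energy
on the compact unit sphere of `K`; the minimum is `minEnergyOn A K`, and a minimiser of the
Rayleigh quotient on an invariant subspace is an eigenvector). Tasaki (2020) §2.2. [folklore] -/
theorem exists_unit_eigen_minEnergyOn {A : Matrix ι ι ℂ} (hA : A.IsHermitian)
    (K : Submodule ℂ (ι → ℂ)) (hKA : ∀ v ∈ K, A *ᵥ v ∈ K) (hK : K ≠ ⊥) :
    ∃ ψ ∈ K, star ψ ⬝ᵥ ψ = 1 ∧ A *ᵥ ψ = ((A.minEnergyOn K : ℝ) : ℂ) • ψ := by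
  classical
  set C : Set (ι → ℂ) := {w | w ∈ K ∧ star w ⬝ᵥ w = 1} with hC
  obtain ⟨w, hwK, hw0⟩ := Submodule.exists_mem_ne_zero_of_ne_bot hK
  obtain ⟨c, -, -, hc1⟩ := exists_normalize hw0
  have hCne : C.Nonempty := ⟨_, K.smul_mem _ hwK, hc1⟩
  obtain ⟨w₀, hw₀C, hmin⟩ :=
    (isCompact_unitSphere_inter K).exists_isMinOn hCne (continuous_energy A).continuousOn
  have hleast : IsLeast {E : ℝ | ∃ ψ ∈ K, star ψ ⬝ᵥ ψ = 1 ∧ E = (star ψ ⬝ᵥ A *ᵥ ψ).re}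
      (star w₀ ⬝ᵥ A *ᵥ w₀).re := by
    refine ⟨⟨w₀, hw₀C.1, hw₀C.2, rfl⟩, ?_⟩
    rintro _ ⟨ψ, hψK, hψ1, rfl⟩
    exact hmin ⟨hψK, hψ1⟩
  have hmin_eq : A.minEnergyOn K = (star w₀ ⬝ᵥ A *ᵥ w₀).re := by
    rw [Matrix.minEnergyOn]
    exact hleast.csInf_eq
  refine ⟨w₀, hw₀C.1, hw₀C.2, ?_⟩
  refine mulVec_eq_smul_of_forall_le_on hA.eq K hKA
    (fun v hv => minEnergyOn_mul_le_re_rayleigh hA K hv) hw₀C.1 ?_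
  rw [hw₀C.2, Complex.one_re, mul_one, hmin_eq]

/-- The sector ground multiplet of an invariant sector `K ≠ ⊥` is non-trivial. [folklore] -/
theorem inf_eigenspace_minEnergyOn_ne_bot {A : Matrix ι ι ℂ} (hA : A.IsHermitian)
    (K : Submodule ℂ (ι → ℂ)) (hKA : ∀ v ∈ K, A *ᵥ v ∈ K) (hK : K ≠ ⊥) :
    K ⊓ Module.End.eigenspace (Matrix.toLin' A) ((A.minEnergyOn K : ℝ) : ℂ) ≠ ⊥ := by
  obtain ⟨ψ, hψK, hψ1, hψ⟩ := exists_unit_eigen_minEnergyOn hA K hKA hK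
  rw [Submodule.ne_bot_iff]
  refine ⟨ψ, (mem_inf_eigenspace_toLin'_iff A K _ ψ).2 ⟨hψK, hψ⟩, ?_⟩
  rintro rfl
  simp at hψ1

/-! ### The gap above the ground multiplet -/

/-- **The gap above the ground multiplet.** For Hermitian `A` and an `A`-invariant sector `K`
there is `g > 0` such that `(e + g) ‖w‖² ≤ Re ⟨w, A w⟩`, `e = minEnergyOn A K`, for every
`w ∈ K` orthogonal to all sector ground eigenvectors (`ψ ∈ K`, `A ψ = e ψ`): the next
eigenvalue of `A|_K` lies strictly above `e`. (Minimise the energy on the unit sphere of the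
invariant subspace `K ∩ E^⊥`; the minimiser is an eigenvector with eigenvalue `μ ≥ e`, and
`μ = e` would put it in `E ∩ E^⊥ = 0`.) [folklore] -/
theorem exists_gap_above_groundMultiplet {A : Matrix ι ι ℂ} (hA : A.IsHermitian)
    (K : Submodule ℂ (ι → ℂ)) (hKA : ∀ v ∈ K, A *ᵥ v ∈ K) :
    ∃ g : ℝ, 0 < g ∧ ∀ w ∈ K,
      (∀ ψ ∈ K, A *ᵥ ψ = ((A.minEnergyOn K : ℝ) : ℂ) • ψ → star ψ ⬝ᵥ w = 0) →
      (A.minEnergyOn K + g) * (star w ⬝ᵥ w).re ≤ (star w ⬝ᵥ A *ᵥ w).re := by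
  classical
  set m : ℝ := A.minEnergyOn K with hm_def
  -- the invariant subspace `W = K ∩ E^⊥`
  let W : Submodule ℂ (ι → ℂ) :=
    { carrier := {w | w ∈ K ∧ ∀ ψ ∈ K, A *ᵥ ψ = (m : ℂ) • ψ → star ψ ⬝ᵥ w = 0}
      add_mem' := fun {a b} ha hb => ⟨K.add_mem ha.1 hb.1, fun ψ hψK hψ => by
        rw [dotProduct_add, ha.2 ψ hψK hψ, hb.2 ψ hψK hψ, add_zero]⟩
      zero_mem' := ⟨K.zero_mem, fun ψ _ _ => dotProduct_zero _⟩
      smul_mem' := fun c {a} ha => ⟨K.smul_mem c ha.1, fun ψ hψK hψ => by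
        rw [dotProduct_smul, ha.2 ψ hψK hψ, smul_zero]⟩ }
  have hWinv : ∀ w ∈ W, A *ᵥ w ∈ W := by
    intro w hw
    refine ⟨hKA w hw.1, fun ψ hψK hψ => ?_⟩
    rw [star_dotProduct_mulVec_comm hA.eq, hψ, dotProduct_smul, smul_eq_mul, star_mul',
      ← star_dotProduct, hw.2 ψ hψK hψ, mul_zero]
  set C : Set (ι → ℂ) := {w | w ∈ W ∧ star w ⬝ᵥ w = 1} with hC
  by_cases hCne : C.Nonempty
  · obtain ⟨w₀, hw₀C, hmin⟩ :=
      (isCompact_unitSphere_inter W).exists_isMinOn hCne (continuous_energy A).continuousOn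
    set μ : ℝ := (star w₀ ⬝ᵥ A *ᵥ w₀).re with hμ
    have hμle : ∀ w ∈ W, μ * (star w ⬝ᵥ w).re ≤ (star w ⬝ᵥ A *ᵥ w).re := by
      intro w hw
      by_cases hw0 : w = 0
      · simp [hw0]
      obtain ⟨c, _, hcc, hc1⟩ := exists_normalize hw0
      have h1 : μ ≤ (star ((c : ℂ) • w) ⬝ᵥ A *ᵥ ((c : ℂ) • w)).re :=
        hmin ⟨W.smul_mem _ hw, hc1⟩
      rw [mulVec_smul, star_real_smul_dotProduct_real_smul, Complex.re_ofReal_mul] at h1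
      have hpos := re_star_dotProduct_self_pos hw0
      calc μ * (star w ⬝ᵥ w).re ≤ c * c * (star w ⬝ᵥ A *ᵥ w).re * (star w ⬝ᵥ w).re :=
            mul_le_mul_of_nonneg_right h1 hpos.le
        _ = (star w ⬝ᵥ A *ᵥ w).re * (c * c * (star w ⬝ᵥ w).re) := by ring
        _ = (star w ⬝ᵥ A *ᵥ w).re := by rw [hcc, mul_one]
    have hw₀W : w₀ ∈ W := hw₀C.1
    have heig : A *ᵥ w₀ = (μ : ℂ) • w₀ :=
      mulVec_eq_smul_of_forall_le_on hA.eq W hWinv hμle hw₀W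
        (by rw [hw₀C.2, Complex.one_re, mul_one])
    have hmμ : m ≤ μ := minEnergyOn_le_rayleigh_of_mem hA K hw₀W.1 hw₀C.2
    have hne : m ≠ μ := by
      intro hmμ'
      have h0 : star w₀ ⬝ᵥ w₀ = 0 := hw₀W.2 w₀ hw₀W.1 (by rw [hmμ']; exact heig)
      rw [hw₀C.2] at h0
      exact one_ne_zero h0
    refine ⟨μ - m, sub_pos.2 (lt_of_le_of_ne hmμ hne), fun w hwK hw => ?_⟩
    rw [add_sub_cancel]
    exact hμle w ⟨hwK, hw⟩
  · refine ⟨1, one_pos, fun w hwK hw => ?_⟩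
    by_cases hw0 : w = 0
    · simp [hw0]
    · obtain ⟨c, -, -, hc1⟩ := exists_normalize hw0
      exact absurd ⟨_, W.smul_mem _ ⟨hwK, hw⟩, hc1⟩ hCne

/-- **The gap in projection form.** For Hermitian `A` and an `A`-invariant sector `K`, with
`e = minEnergyOn A K` and `P` the orthogonal projection onto the ground multiplet
`K ⊓ ker (A - e)`: for some `g > 0`, `e ‖v‖² + g (‖v‖² - Re ⟨v, P v⟩) ≤ Re ⟨v, A v⟩` for every
`v ∈ K` (split `v = P v + w`, `w ∈ K ∩ E^⊥`; the cross terms vanish and `w` feels the gap).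
[folklore] -/
theorem exists_gap_groundProj_form {A : Matrix ι ι ℂ} (hA : A.IsHermitian)
    (K : Submodule ℂ (ι → ℂ)) (hKA : ∀ v ∈ K, A *ᵥ v ∈ K) :
    ∃ g : ℝ, 0 < g ∧ ∀ v ∈ K,
      A.minEnergyOn K * (star v ⬝ᵥ v).re +
          g * ((star v ⬝ᵥ v).re - (star v ⬝ᵥ projMatrix ((K ⊓ Module.End.eigenspace
            (Matrix.toLin' A) ((A.minEnergyOn K : ℝ) : ℂ)).map
            ((WithLp.linearEquiv 2 ℂ (ι → ℂ)).symm : (ι → ℂ) →ₗ[ℂ] EuclideanSpace ℂ ι)) *ᵥ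
              v).re) ≤
        (star v ⬝ᵥ A *ᵥ v).re := by
  classical
  obtain ⟨g, hg, hgap⟩ := exists_gap_above_groundMultiplet hA K hKA
  refine ⟨g, hg, fun v hv => ?_⟩
  set m : ℝ := A.minEnergyOn K with hm_def
  set E : Submodule ℂ (ι → ℂ) := K ⊓ Module.End.eigenspace (Matrix.toLin' A) (m : ℂ)
    with hE_def
  set P : Matrix ι ι ℂ := projMatrix (E.map
    ((WithLp.linearEquiv 2 ℂ (ι → ℂ)).symm : (ι → ℂ) →ₗ[ℂ] EuclideanSpace ℂ ι)) with hP_def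
  have hPh : P.IsHermitian := projMatrix_isHermitian _
  have hmemE : ∀ ψ, ψ ∈ E ↔ ψ ∈ K ∧ A *ᵥ ψ = (m : ℂ) • ψ := fun ψ =>
    mem_inf_eigenspace_toLin'_iff A K m ψ
  -- `p = P v ∈ E`, `w = v - p ∈ K ∩ E^⊥`
  set p : ι → ℂ := P *ᵥ v with hp_def
  set w : ι → ℂ := v - p with hw_def
  have hpE : p ∈ E := projMatrix_map_mulVec_mem E v
  obtain ⟨hpK, hAp⟩ := (hmemE p).1 hpE
  have hwK : w ∈ K := K.sub_mem hv hpK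
  have hPψ : ∀ ψ ∈ E, star ψ ⬝ᵥ p = star ψ ⬝ᵥ v := by
    intro ψ hψ
    have hfix : P *ᵥ ψ = ψ := projMatrix_map_mulVec_of_mem E hψ
    rw [hp_def]
    conv_rhs => rw [← hfix]
    rw [star_mulVec, hPh.eq, ← dotProduct_mulVec]
  have hworth : ∀ ψ ∈ K, A *ᵥ ψ = (m : ℂ) • ψ → star ψ ⬝ᵥ w = 0 := by
    intro ψ hψK hψ
    rw [hw_def, dotProduct_sub, hPψ ψ ((hmemE ψ).2 ⟨hψK, hψ⟩), sub_self]
  have hgapw := hgap w hwK hworth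
  have hpw : star p ⬝ᵥ w = 0 := hworth p hpK hAp
  have hwp : star w ⬝ᵥ p = 0 := by rw [star_dotProduct, hpw, star_zero]
  have hwAp : star w ⬝ᵥ A *ᵥ p = 0 := by rw [hAp, dotProduct_smul, hwp, smul_zero]
  have hpAw : star p ⬝ᵥ A *ᵥ w = 0 := by
    rw [star_dotProduct_mulVec_comm hA.eq, hwAp, star_zero]
  have hv_eq : v = p + w := by rw [hw_def, add_sub_cancel]
  have h1 : star v ⬝ᵥ A *ᵥ v = (m : ℂ) * (star p ⬝ᵥ p) + star w ⬝ᵥ A *ᵥ w := by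
    conv_lhs => rw [hv_eq]
    rw [mulVec_add, star_add, add_dotProduct, dotProduct_add, dotProduct_add, hpAw, hwAp,
      hAp, dotProduct_smul, smul_eq_mul]
    ring
  have h2 : star v ⬝ᵥ v = star p ⬝ᵥ p + star w ⬝ᵥ w := by
    conv_lhs => rw [hv_eq]
    rw [star_add, add_dotProduct, dotProduct_add, dotProduct_add, hpw, hwp]
    ring
  have h3 : star v ⬝ᵥ p = star p ⬝ᵥ p := by
    conv_lhs => rw [hv_eq]
    rw [star_add, add_dotProduct, hwp, add_zero]
  have h1re : (star v ⬝ᵥ A *ᵥ v).re = m * (star p ⬝ᵥ p).re + (star w ⬝ᵥ A *ᵥ w).re := by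
    rw [h1, Complex.add_re, Complex.re_ofReal_mul]
  have h2re : (star v ⬝ᵥ v).re = (star p ⬝ᵥ p).re + (star w ⬝ᵥ w).re := by
    rw [h2, Complex.add_re]
  have h3re : (star v ⬝ᵥ p).re = (star p ⬝ᵥ p).re := by rw [h3]
  rw [h1re, h2re, h3re]
  nlinarith [hgapw]

/-! ### Traces against the projection onto a subspace -/

/-- **Frame expansion of `tr (P_E M)`.** For a subspace `E ≤ ℂ^ι` there is an orthonormal
frame `b₁, …, b_k` of `E` (`k = dim E`, unit vectors of `E`) with
`tr (P_E M) = Σⱼ ⟨bⱼ, M bⱼ⟩` for every matrix `M`, `P_E = projMatrix (E.map toEuclidean)`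
(`P_E = B Bᴴ` for the frame matrix `B`, `exists_orthonormalFrame`). [folklore] -/
theorem exists_frame_trace_projMatrix_map_mul (E : Submodule ℂ (ι → ℂ)) :
    ∃ (k : ℕ) (b : Fin k → ι → ℂ), k = Module.finrank ℂ E ∧ (∀ j, b j ∈ E) ∧
      (∀ j, star (b j) ⬝ᵥ b j = 1) ∧
      ∀ M : Matrix ι ι ℂ, (projMatrix (E.map
        ((WithLp.linearEquiv 2 ℂ (ι → ℂ)).symm : (ι → ℂ) →ₗ[ℂ] EuclideanSpace ℂ ι)) * M).trace =
          ∑ j, star (b j) ⬝ᵥ M *ᵥ b j := by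
  obtain ⟨k, B, hk, hBB, hcol, hfix⟩ := exists_orthonormalFrame E
  have hP : projMatrix (E.map
      ((WithLp.linearEquiv 2 ℂ (ι → ℂ)).symm : (ι → ℂ) →ₗ[ℂ] EuclideanSpace ℂ ι)) = B * Bᴴ :=
    proj_unique (projMatrix_isHermitian _) (Matrix.isHermitian_mul_conjTranspose_self B)
      (fun _ hw => projMatrix_map_mulVec_of_mem E hw) (projMatrix_map_mulVec_mem E) hfix
      (frame_proj_mulVec_mem hcol)
  refine ⟨k, fun j x => B x j, hk, hcol, fun j => ?_, fun M => ?_⟩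
  · have := congrFun (congrFun hBB j) j
    simpa [Matrix.mul_apply, Matrix.conjTranspose_apply, dotProduct, Matrix.one_apply] using this
  · rw [hP, Matrix.mul_assoc, Matrix.trace_mul_comm, Matrix.mul_assoc, Matrix.trace]
    simp only [Matrix.diag_apply]
    refine Finset.sum_congr rfl fun j _ => ?_
    simp only [Matrix.mul_apply, Matrix.conjTranspose_apply, dotProduct, Matrix.mulVec,
      Pi.star_apply]

/-- `Re tr P_E = dim E`. [folklore] -/
theorem re_trace_projMatrix_map_eq_finrank (E : Submodule ℂ (ι → ℂ)) :
    (projMatrix (E.map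
      ((WithLp.linearEquiv 2 ℂ (ι → ℂ)).symm : (ι → ℂ) →ₗ[ℂ] EuclideanSpace ℂ ι))).trace.re =
      Module.finrank ℂ E := by
  rw [trace_projMatrix_map_eq_finrank, Complex.natCast_re]

/-- **`Re tr (Q P_E) ≤ dim E` for a Hermitian idempotent `Q`** (`= Σⱼ Re ⟨bⱼ, Q bⱼ⟩ ≤ Σⱼ 1`
over an orthonormal frame of `E`). [folklore] -/
theorem re_trace_mul_projMatrix_map_le {Q : Matrix ι ι ℂ} (hQ : Q.IsHermitian)
    (hQQ : Q * Q = Q) (E : Submodule ℂ (ι → ℂ)) :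
    (Q * projMatrix (E.map
      ((WithLp.linearEquiv 2 ℂ (ι → ℂ)).symm : (ι → ℂ) →ₗ[ℂ] EuclideanSpace ℂ ι))).trace.re ≤
      Module.finrank ℂ E := by
  obtain ⟨k, b, hk, -, hb1, htr⟩ := exists_frame_trace_projMatrix_map_mul E
  rw [Matrix.trace_mul_comm, htr, Complex.re_sum, ← hk]
  calc ∑ j, (star (b j) ⬝ᵥ Q *ᵥ b j).re ≤ ∑ j : Fin k, (star (b j) ⬝ᵥ b j).re :=
        Finset.sum_le_sum fun j _ => re_dotProduct_mulVec_le hQ hQQ (b j)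
    _ = k := by simp [hb1]

/-! ### Two elementary matrix estimates -/

omit [DecidableEq ι] in
/-- `|Re ⟨b, Y b⟩| ≤ Σᵢₖ |Yᵢₖ|` for a unit vector `b` (each `|bᵢ| ≤ 1`). [folklore] -/
theorem abs_re_rayleigh_le_sum_norm (Y : Matrix ι ι ℂ) {b : ι → ℂ} (hb : star b ⬝ᵥ b = 1) :
    |(star b ⬝ᵥ Y *ᵥ b).re| ≤ ∑ i, ∑ k, ‖Y i k‖ := by
  have hb1 : ∀ i, ‖b i‖ ≤ 1 := fun i => by
    have h := norm_apply_sq_le b i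
    rw [hb, Complex.one_re] at h
    nlinarith [norm_nonneg (b i)]
  have hrow : ∀ i, ‖star (b i) * ∑ k, Y i k * b k‖ ≤ ∑ k, ‖Y i k‖ := by
    intro i
    rw [norm_mul, norm_star]
    calc ‖b i‖ * ‖∑ k, Y i k * b k‖ ≤ 1 * ∑ k, ‖Y i k‖ := by
          refine mul_le_mul (hb1 i) ?_ (norm_nonneg _) zero_le_one
          calc ‖∑ k, Y i k * b k‖ ≤ ∑ k, ‖Y i k * b k‖ := norm_sum_le _ _
            _ ≤ ∑ k, ‖Y i k‖ := Finset.sum_le_sum fun k _ => by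
                rw [norm_mul]; exact mul_le_of_le_one_right (norm_nonneg _) (hb1 k)
      _ = ∑ k, ‖Y i k‖ := one_mul _
  calc |(star b ⬝ᵥ Y *ᵥ b).re| ≤ ‖star b ⬝ᵥ Y *ᵥ b‖ := Complex.abs_re_le_norm _
    _ = ‖∑ i, star (b i) * ∑ k, Y i k * b k‖ := by
        simp only [dotProduct, mulVec, Pi.star_apply]
    _ ≤ ∑ i, ‖star (b i) * ∑ k, Y i k * b k‖ := norm_sum_le _ _
    _ ≤ ∑ i, ∑ k, ‖Y i k‖ := Finset.sum_le_sum fun i _ => hrow i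

omit [DecidableEq ι] in
/-- **Hilbert–Schmidt distance of two projections of equal rank.** For Hermitian idempotents
`P`, `Q` with `Re tr P = Re tr Q = d`: `|(P - Q)ᵢⱼ|² ≤ Σ |(P - Q)ᵢⱼ|² = Re tr (P - Q)² =
2 (d - Re tr (P Q))`. [folklore] -/
theorem norm_sub_apply_sq_le_of_proj {P Q : Matrix ι ι ℂ} (hP : P.IsHermitian)
    (hPP : P * P = P) (hQ : Q.IsHermitian) (hQQ : Q * Q = Q) {d : ℝ} (hPd : P.trace.re = d)
    (hQd : Q.trace.re = d) (i j : ι) : ‖(P - Q) i j‖ ^ 2 ≤ 2 * (d - (P * Q).trace.re) := by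
  set M := P - Q with hM_def
  have hM : Mᴴ = M := by rw [hM_def, conjTranspose_sub, hP.eq, hQ.eq]
  have hsum : (M * M).trace.re = ∑ i, ∑ j, ‖M i j‖ ^ 2 := by
    simp only [Matrix.trace, Matrix.diag_apply, Matrix.mul_apply, Complex.re_sum]
    refine Finset.sum_congr rfl fun i _ => Finset.sum_congr rfl fun j _ => ?_
    have hji : M j i = star (M i j) := by
      rw [← congrFun (congrFun hM j) i, conjTranspose_apply]
    rw [hji, Complex.star_def, Complex.mul_conj, Complex.ofReal_re, Complex.normSq_eq_norm_sq]
  have htr : (M * M).trace.re = 2 * (d - (P * Q).trace.re) := by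
    have hQP : (Q * P).trace = (P * Q).trace := Matrix.trace_mul_comm Q P
    rw [hM_def, sub_mul, mul_sub, mul_sub, hPP, hQQ, trace_sub, trace_sub, trace_sub, hQP]
    simp only [Complex.sub_re]
    rw [hPd, hQd]
    ring
  calc ‖(P - Q) i j‖ ^ 2 = ‖M i j‖ ^ 2 := rfl
    _ ≤ ∑ j', ‖M i j'‖ ^ 2 :=
        Finset.single_le_sum (f := fun j' => ‖M i j'‖ ^ 2) (fun _ _ => by positivity)
          (Finset.mem_univ j)
    _ ≤ ∑ i', ∑ j', ‖M i' j'‖ ^ 2 :=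
        Finset.single_le_sum (f := fun i' => ∑ j', ‖M i' j'‖ ^ 2) (fun _ _ => by positivity)
          (Finset.mem_univ i)
    _ = 2 * (d - (P * Q).trace.re) := by rw [← hsum, htr]


/-! ### The core estimate -/

/-- **Core estimate.** If `A₀` satisfies the gap inequality
`e₀ ‖v‖² + g (‖v‖² - Re ⟨v, P₀ v⟩) ≤ Re ⟨v, A₀ v⟩` on `K` (`exists_gap_groundProj_form`) and every
unit vector `b` of a subspace `E₁ ≤ K` has `Re ⟨b, A₀ b⟩ ≤ α`, then
`g (dim E₁ - Re tr (P_{E₁} P₀)) ≤ dim E₁ · (α - e₀)` (sum the two inequalities over an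
orthonormal frame of `E₁`, `exists_frame_trace_projMatrix_map_mul`). [folklore] -/
theorem gap_mul_finrank_sub_re_trace_le {A₀ P₀ : Matrix ι ι ℂ} (K : Submodule ℂ (ι → ℂ))
    {e₀ g : ℝ}
    (hgap : ∀ v ∈ K, e₀ * (star v ⬝ᵥ v).re + g * ((star v ⬝ᵥ v).re - (star v ⬝ᵥ P₀ *ᵥ v).re) ≤
      (star v ⬝ᵥ A₀ *ᵥ v).re)
    (E₁ : Submodule ℂ (ι → ℂ)) (hE₁K : E₁ ≤ K) {α : ℝ}
    (hup : ∀ b ∈ E₁, star b ⬝ᵥ b = 1 → (star b ⬝ᵥ A₀ *ᵥ b).re ≤ α) :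
    g * ((Module.finrank ℂ E₁ : ℝ) - (projMatrix (E₁.map
        ((WithLp.linearEquiv 2 ℂ (ι → ℂ)).symm : (ι → ℂ) →ₗ[ℂ] EuclideanSpace ℂ ι)) *
          P₀).trace.re) ≤
      (Module.finrank ℂ E₁ : ℝ) * (α - e₀) := by
  obtain ⟨k, b, hk, hbE, hb1, htr⟩ := exists_frame_trace_projMatrix_map_mul E₁
  rw [htr, Complex.re_sum, ← hk]
  have hlow : ∀ j, e₀ + g * (1 - (star (b j) ⬝ᵥ P₀ *ᵥ b j).re) ≤
      (star (b j) ⬝ᵥ A₀ *ᵥ b j).re := by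
    intro j
    have h := hgap (b j) (hE₁K (hbE j))
    rw [hb1 j, Complex.one_re] at h
    linarith
  have hsum_low : ∑ j : Fin k, (e₀ + g * (1 - (star (b j) ⬝ᵥ P₀ *ᵥ b j).re)) ≤
      ∑ j, (star (b j) ⬝ᵥ A₀ *ᵥ b j).re :=
    Finset.sum_le_sum fun j _ => hlow j
  have hsum_up : ∑ j : Fin k, (star (b j) ⬝ᵥ A₀ *ᵥ b j).re ≤ ∑ _j : Fin k, α :=
    Finset.sum_le_sum fun j _ => hup (b j) (hbE j) (hb1 j)
  have hexp : ∑ j : Fin k, (e₀ + g * (1 - (star (b j) ⬝ᵥ P₀ *ᵥ b j).re)) =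
      (k : ℝ) * e₀ + g * ((k : ℝ) - ∑ j, (star (b j) ⬝ᵥ P₀ *ᵥ b j).re) := by
    simp only [Finset.sum_add_distrib, Finset.mul_sum, Finset.sum_sub_distrib, mul_sub,
      Finset.sum_const, Finset.card_univ, Fintype.card_fin, nsmul_eq_mul, mul_one]
    ring
  have hconst : ∑ _j : Fin k, α = (k : ℝ) * α := by simp
  rw [hexp] at hsum_low
  rw [hconst] at hsum_up
  linarith

/-! ### The theorem, for a pencil given by defining equations -/

/-- **Continuity of the sector ground projection off a closed nowhere dense set** (abstract
form: the pencil `A`, its sector energy `e`, ground multiplet `E` and projection `P` are given by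
their defining equations). For Hermitian `H`, `Y` and a sector `K ≠ ⊥` invariant under both,
there is a closed `C ⊆ ℝ` with empty interior such that `u ↦ P(u)` is continuous on `ℝ \ C`, and
`ℝ \ C` is exactly the set of points at which `dim E(u)` is locally constant (u.s.c. of `dim E` and
Hilbert–Schmidt convergence of `P(u)` from the core estimate; `C` = points of non-constancy of
`dim E`); cf. Kato (1966) II-§5.1. [folklore] -/
theorem exists_isClosed_interior_empty_continuousOn_of_pencil
    {H Y : Matrix ι ι ℂ} (hH : H.IsHermitian) (hY : Y.IsHermitian) (K : Submodule ℂ (ι → ℂ))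
    (hKH : ∀ v ∈ K, H *ᵥ v ∈ K) (hKY : ∀ v ∈ K, Y *ᵥ v ∈ K) (hK : K ≠ ⊥)
    {A : ℝ → Matrix ι ι ℂ} {e : ℝ → ℝ} {E : ℝ → Submodule ℂ (ι → ℂ)} {P : ℝ → Matrix ι ι ℂ}
    (hA : ∀ u, A u = H + (u : ℂ) • Y) (he : ∀ u, e u = (A u).minEnergyOn K)
    (hE : ∀ u, E u = K ⊓ Module.End.eigenspace (Matrix.toLin' (A u)) ((e u : ℝ) : ℂ))
    (hP : ∀ u, P u = projMatrix ((E u).map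
      ((WithLp.linearEquiv 2 ℂ (ι → ℂ)).symm : (ι → ℂ) →ₗ[ℂ] EuclideanSpace ℂ ι))) :
    ∃ C : Set ℝ, IsClosed C ∧ interior C = ∅ ∧ ContinuousOn P Cᶜ ∧
      ∀ u, u ∉ C ↔ ∀ᶠ v in 𝓝 u, Module.finrank ℂ (E v) = Module.finrank ℂ (E u) := by
  classical
  -- facts at each coupling
  have hAh : ∀ u, (A u).IsHermitian := fun u => by
    rw [hA]; exact isHermitian_add_ofReal_smul hH hY u
  have hAK : ∀ u, ∀ v ∈ K, A u *ᵥ v ∈ K := fun u v hv => by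
    rw [hA, add_mulVec, smul_mulVec]
    exact K.add_mem (hKH v hv) (K.smul_mem _ (hKY v hv))
  have hEK : ∀ u, E u ≤ K := fun u => by rw [hE]; exact inf_le_left
  have hEeig : ∀ u, ∀ b ∈ E u, A u *ᵥ b = ((e u : ℝ) : ℂ) • b := fun u b hb => by
    rw [hE] at hb
    exact ((mem_inf_eigenspace_toLin'_iff _ _ _ _).1 hb).2
  have hPh : ∀ u, (P u).IsHermitian := fun u => by rw [hP]; exact projMatrix_isHermitian _
  have hPP : ∀ u, P u * P u = P u := fun u => by rw [hP]; exact projMatrix_mul_self _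
  set d : ℝ → ℕ := fun u => Module.finrank ℂ (E u) with hd
  have htr : ∀ u, (P u).trace.re = d u := fun u => by
    rw [hP]; exact re_trace_projMatrix_map_eq_finrank _
  have hdle : ∀ u, (d u : ℝ) ≤ Fintype.card ι := fun u => by
    have h1 : Module.finrank ℂ (E u) ≤ Module.finrank ℂ (ι → ℂ) := Submodule.finrank_le _
    rw [Module.finrank_fintype_fun_eq_card] at h1
    exact_mod_cast h1
  -- the key estimate around each coupling `u₀`
  have key : ∀ u₀ : ℝ, ∃ M : ℝ, 0 ≤ M ∧ ∃ g : ℝ, 0 < g ∧ ∀ u,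
      g * ((d u : ℝ) - (P u * P u₀).trace.re) ≤ |u - u₀| * M ∧
      (P u * P u₀).trace.re ≤ d u₀ := by
    intro u₀
    obtain ⟨g, hg, hgap⟩ := exists_gap_groundProj_form (hAh u₀) K (hAK u₀)
    rw [← he, ← hE, ← hP] at hgap
    obtain ⟨ψ₀, hψ₀K, hψ₀1, hψ₀eig⟩ := exists_unit_eigen_minEnergyOn (hAh u₀) K (hAK u₀) hK
    set y₀ : ℝ := (star ψ₀ ⬝ᵥ Y *ᵥ ψ₀).re with hy₀
    set R : ℝ := ∑ i, ∑ k, ‖Y i k‖ with hR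
    have hR0 : 0 ≤ R := Finset.sum_nonneg fun i _ => Finset.sum_nonneg fun k _ => norm_nonneg _
    -- the supergradient inequality at `u₀`
    have hψ₀eig' : (H + (u₀ : ℂ) • Y) *ᵥ ψ₀ =
        (((H + (u₀ : ℂ) • Y).minEnergyOn K : ℝ) : ℂ) • ψ₀ := by rw [← hA]; exact hψ₀eig
    have hFH : ∀ u, e u ≤ e u₀ + (u - u₀) * y₀ := by
      intro u
      have h := minEnergyOn_pencil_le_of_ground hH hY K hψ₀K hψ₀1
        (re_rayleigh_of_eigen_minEnergyOn _ K hψ₀1 hψ₀eig') u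
      rwa [← hA, ← hA, ← he, ← he] at h
    -- the Rayleigh quotient is affine along the pencil
    have hsplit : ∀ (s : ℝ) (b : ι → ℂ), (star b ⬝ᵥ A s *ᵥ b).re =
        (star b ⬝ᵥ H *ᵥ b).re + s * (star b ⬝ᵥ Y *ᵥ b).re := by
      intro s b
      rw [hA, add_mulVec, smul_mulVec, dotProduct_add, dotProduct_smul, Complex.add_re,
        smul_eq_mul, Complex.re_ofReal_mul]
    refine ⟨(Fintype.card ι : ℝ) * (|y₀| + R), by positivity, g, hg, fun u => ⟨?_, ?_⟩⟩
    · -- unit vectors of `E u` have `Re ⟨b, A u₀ b⟩ ≤ e u + |u - u₀| R`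
      have hup : ∀ b ∈ E u, star b ⬝ᵥ b = 1 →
          (star b ⬝ᵥ A u₀ *ᵥ b).re ≤ e u + |u - u₀| * R := by
        intro b hb hb1
        have heu : (star b ⬝ᵥ A u *ᵥ b).re = e u := by
          rw [hEeig u b hb, dotProduct_smul, hb1, smul_eq_mul, mul_one, Complex.ofReal_re]
        have hYb := abs_re_rayleigh_le_sum_norm Y hb1
        rw [hsplit u₀]
        rw [hsplit u] at heu
        have : (u₀ - u) * (star b ⬝ᵥ Y *ᵥ b).re ≤ |u - u₀| * R := by
          calc (u₀ - u) * (star b ⬝ᵥ Y *ᵥ b).re ≤ |(u₀ - u) * (star b ⬝ᵥ Y *ᵥ b).re| :=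
                le_abs_self _
            _ = |u - u₀| * |(star b ⬝ᵥ Y *ᵥ b).re| := by rw [abs_mul, abs_sub_comm]
            _ ≤ |u - u₀| * R := mul_le_mul_of_nonneg_left hYb (abs_nonneg _)
        linarith
      have hcore := gap_mul_finrank_sub_re_trace_le K hgap (E u) (hEK u) hup
      rw [← hP] at hcore
      have hd0 : (0 : ℝ) ≤ d u := Nat.cast_nonneg _
      have hFHu := hFH u
      have hyy : (u - u₀) * y₀ ≤ |u - u₀| * |y₀| := by
        calc (u - u₀) * y₀ ≤ |(u - u₀) * y₀| := le_abs_self _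
          _ = |u - u₀| * |y₀| := abs_mul _ _
      calc g * ((d u : ℝ) - (P u * P u₀).trace.re)
          ≤ (d u : ℝ) * (e u + |u - u₀| * R - e u₀) := hcore
        _ ≤ (d u : ℝ) * (|u - u₀| * (|y₀| + R)) :=
            mul_le_mul_of_nonneg_left (by linarith) hd0
        _ ≤ (Fintype.card ι : ℝ) * (|u - u₀| * (|y₀| + R)) :=
            mul_le_mul_of_nonneg_right (hdle u) (by positivity)
        _ = |u - u₀| * ((Fintype.card ι : ℝ) * (|y₀| + R)) := by ring
    · have h := re_trace_mul_projMatrix_map_le (hPh u) (hPP u) (E u₀)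
      rwa [← hP] at h
  -- (i) upper semicontinuity of `d = dim E`
  have usc : ∀ u₀, ∀ᶠ u in 𝓝 u₀, d u ≤ d u₀ := by
    intro u₀
    obtain ⟨M, hM, g, hg, hkey⟩ := key u₀
    rw [Metric.eventually_nhds_iff]
    refine ⟨g / (M + 1), by positivity, fun u hu => ?_⟩
    rw [Real.dist_eq] at hu
    obtain ⟨h1, h2⟩ := hkey u
    have h3 : g * ((d u : ℝ) - d u₀) < g := by
      calc g * ((d u : ℝ) - d u₀) ≤ g * ((d u : ℝ) - (P u * P u₀).trace.re) :=
            mul_le_mul_of_nonneg_left (by linarith) hg.le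
        _ ≤ |u - u₀| * M := h1
        _ ≤ g / (M + 1) * M := mul_le_mul_of_nonneg_right hu.le hM
        _ < g := by
            rw [div_mul_eq_mul_div, div_lt_iff₀ (by positivity)]
            nlinarith
    have h4 : (d u : ℝ) - d u₀ < 1 := by
      by_contra h5
      have : g * 1 ≤ g * ((d u : ℝ) - d u₀) := mul_le_mul_of_nonneg_left (not_lt.1 h5) hg.le
      linarith
    have h6 : d u < d u₀ + 1 := by
      have : (d u : ℝ) < d u₀ + 1 := by linarith
      exact_mod_cast this
    exact Nat.lt_add_one_iff.1 h6
  -- (ii) continuity of `P` at points of local constancy of `d`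
  have cont : ∀ u₀, (∀ᶠ u in 𝓝 u₀, d u = d u₀) → ContinuousAt P u₀ := by
    intro u₀ hloc
    obtain ⟨M, hM, g, hg, hkey⟩ := key u₀
    obtain ⟨δ₁, hδ₁, hloc'⟩ := Metric.eventually_nhds_iff.1 hloc
    refine continuousAt_pi.2 fun i => continuousAt_pi.2 fun j => ?_
    rw [Metric.continuousAt_iff]
    intro ε hε
    refine ⟨min δ₁ (ε ^ 2 * g / (2 * (M + 1))), lt_min hδ₁ (by positivity), fun u hu => ?_⟩
    have hu1 : dist u u₀ < δ₁ := lt_of_lt_of_le hu (min_le_left _ _)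
    have hu2 : |u - u₀| < ε ^ 2 * g / (2 * (M + 1)) := by
      rw [← Real.dist_eq]; exact lt_of_lt_of_le hu (min_le_right _ _)
    have hdu : d u = d u₀ := hloc' hu1
    obtain ⟨h1, -⟩ := hkey u
    rw [hdu] at h1
    have hsq := norm_sub_apply_sq_le_of_proj (hPh u) (hPP u) (hPh u₀) (hPP u₀)
      (by rw [htr, hdu]) (htr u₀) i j
    have hlt : ‖(P u - P u₀) i j‖ ^ 2 < ε ^ 2 := by
      calc ‖(P u - P u₀) i j‖ ^ 2 ≤ 2 * ((d u₀ : ℝ) - (P u * P u₀).trace.re) := hsq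
        _ ≤ 2 * (|u - u₀| * M / g) := by
            refine mul_le_mul_of_nonneg_left ?_ (by norm_num)
            rw [le_div_iff₀ hg]
            linarith
        _ = (2 / g) * (|u - u₀| * M) := by ring
        _ ≤ (2 / g) * (|u - u₀| * (M + 1)) := by
            refine mul_le_mul_of_nonneg_left ?_ (by positivity)
            exact mul_le_mul_of_nonneg_left (by linarith) (abs_nonneg _)
        _ < (2 / g) * (ε ^ 2 * g / (2 * (M + 1)) * (M + 1)) := by
            refine mul_lt_mul_of_pos_left ?_ (by positivity)
            exact mul_lt_mul_of_pos_right hu2 (by positivity)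
        _ = ε ^ 2 := by field_simp
    rw [dist_eq_norm, ← Matrix.sub_apply]
    exact lt_of_pow_lt_pow_left₀ 2 hε.le hlt
  -- (iii) the exceptional set: points where `d` is not locally constant
  set C : Set ℝ := {u | ¬ ∀ᶠ v in 𝓝 u, d v = d u} with hC
  have hmemC : ∀ u, u ∉ C ↔ ∀ᶠ v in 𝓝 u, d v = d u := fun u => by
    simp only [hC, mem_setOf_eq, not_not]
  have hopen : IsOpen Cᶜ := by
    rw [isOpen_iff_mem_nhds]
    intro u hu
    obtain ⟨t, ht, hto, hut⟩ := eventually_nhds_iff.1 ((hmemC u).1 hu)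
    refine Filter.mem_of_superset (hto.mem_nhds hut) fun u' hu' => (hmemC u').2 ?_
    exact eventually_nhds_iff.2 ⟨t, fun v hv => (ht v hv).trans (ht u' hu').symm, hto, hu'⟩
  have hclosed : IsClosed C := by simpa using hopen.isClosed_compl
  have hint : interior C = ∅ := by
    by_contra hne
    obtain ⟨x, hx⟩ := Set.nonempty_iff_ne_empty.2 hne
    have hex : ∃ n, ∃ v ∈ interior C, d v = n := ⟨_, x, hx, rfl⟩
    obtain ⟨ustar, hustar, hdustar⟩ := Nat.find_spec hex
    have hmin : ∀ v ∈ interior C, Nat.find hex ≤ d v := fun v hv =>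
      Nat.find_min' hex ⟨v, hv, rfl⟩
    have hloc : ∀ᶠ v in 𝓝 ustar, d v = d ustar := by
      filter_upwards [usc ustar, isOpen_interior.mem_nhds hustar] with v hv1 hv2
      exact le_antisymm hv1 (by rw [hdustar]; exact hmin v hv2)
    exact (interior_subset hustar : ustar ∈ C) hloc
  exact ⟨C, hclosed, hint, fun u hu => (cont u ((hmemC u).1 hu)).continuousWithinAt, hmemC⟩

/-- **Continuity of the sector ground projection along an affine Hermitian pencil, off a closed
nowhere dense set.** For Hermitian `H`, `Y` and a sector `K ≠ ⊥` invariant under both, there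
is a closed nowhere dense `C ⊆ ℝ` such that the orthogonal projection onto the sector ground
multiplet `K ⊓ ker (H + uY - minEnergyOn (H + uY) K)` is a continuous function of `u` on
`ℝ \ C`, and `ℝ \ C` is exactly the set of couplings at which the multiplicity
`dim (K ⊓ ker (H + uY - e(u)))` is locally constant.
Cf. Kato (1966) II-§5.1 (continuity of the total projection of an eigenvalue group that does not
split); finiteness of `C` on bounded intervals (Rellich; Kato (1966) II-§6.1) is not asserted
here. [folklore] -/
theorem exists_isClosed_isNowhereDense_continuousOn_sectorGroundProj
    {H Y : Matrix ι ι ℂ} (hH : H.IsHermitian) (hY : Y.IsHermitian) (K : Submodule ℂ (ι → ℂ))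
    (hKH : ∀ v ∈ K, H *ᵥ v ∈ K) (hKY : ∀ v ∈ K, Y *ᵥ v ∈ K) (hK : K ≠ ⊥) :
    ∃ C : Set ℝ, IsClosed C ∧ IsNowhereDense C ∧
      ContinuousOn (fun u : ℝ => projMatrix ((K ⊓ Module.End.eigenspace
        (Matrix.toLin' (H + (u : ℂ) • Y)) (((H + (u : ℂ) • Y).minEnergyOn K : ℝ) : ℂ)).map
        ((WithLp.linearEquiv 2 ℂ (ι → ℂ)).symm : (ι → ℂ) →ₗ[ℂ] EuclideanSpace ℂ ι))) Cᶜ ∧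
      ∀ u, u ∉ C ↔ ∀ᶠ v : ℝ in 𝓝 u,
        Module.finrank ℂ ↥(K ⊓ Module.End.eigenspace (Matrix.toLin' (H + (v : ℂ) • Y))
          (((H + (v : ℂ) • Y).minEnergyOn K : ℝ) : ℂ)) =
        Module.finrank ℂ ↥(K ⊓ Module.End.eigenspace (Matrix.toLin' (H + (u : ℂ) • Y))
          (((H + (u : ℂ) • Y).minEnergyOn K : ℝ) : ℂ)) := by
  obtain ⟨C, hC, hint, hcont, hloc⟩ :=
    exists_isClosed_interior_empty_continuousOn_of_pencil hH hY K hKH hKY hK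
      (A := fun u => H + (u : ℂ) • Y) (e := fun u => (H + (u : ℂ) • Y).minEnergyOn K)
      (E := fun u => K ⊓ Module.End.eigenspace (Matrix.toLin' (H + (u : ℂ) • Y))
        (((H + (u : ℂ) • Y).minEnergyOn K : ℝ) : ℂ))
      (P := fun u => projMatrix ((K ⊓ Module.End.eigenspace (Matrix.toLin' (H + (u : ℂ) • Y))
        (((H + (u : ℂ) • Y).minEnergyOn K : ℝ) : ℂ)).map
        ((WithLp.linearEquiv 2 ℂ (ι → ℂ)).symm : (ι → ℂ) →ₗ[ℂ] EuclideanSpace ℂ ι)))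
      (fun _ => rfl) (fun _ => rfl) (fun _ => rfl) (fun _ => rfl)
  refine ⟨C, hC, ?_, hcont, hloc⟩
  rw [IsNowhereDense, hC.closure_eq]
  exact hint

end Literature.MathematicalPhysics.QuantumLattice
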